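import Summits.Ventures.PackingBounds.ThreePointCert.CheckIdKS

/-!
# Kronecker-substitution checks of `(i')` and `(ii')`: bounds and soundness

Framing: lottery ticket; floor = certified bounds/negative ranges. Venture `PackingBounds`
(cell `pub-packcert`), three-point SDP family — kernel-checking infrastructure.

Second half of `ThreePointCert.CheckIdKS`: the coefficient sums (`absSum_qII`, `absSum_qI`) and
exponent boxes of the identity polynomials `qII`, `qI`; from a passing `idCheckII` / `idCheckI`
the exact identities `target = rhs + c₀ + ρ` with `Σ|ρ| ≤ c₀` (`idII_spec`, `idI_spec`), hence the
inequalities `FII3S2_of_idKS`, `AF3_of_idKS` (conclusions and proof tails of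
`SoundNN.FII3S2_of_checkSplitNN` / `AF3_of_checkNN`), and the final theorem `card_le_of_cert3KS`
(the conclusion of `card_le_of_cert3S2splitNN`, Bachoc–Vallentin multiplier set, mode `sym2`).
-/

noncomputable section

open Finset
open scoped RealInnerProductSpace

namespace Summit.Ventures.PackingBounds.ThreePointCert

open Literature.Geometry.DiscreteGeometry Literature.Geometry.DiscreteGeometry.PolyCert
open Literature.Geometry.DiscreteGeometry.PolyCert.SPoly
open Literature.Analysis.SpecialFunctions

/-! ### Coefficient sums -/

/-- `absSum (qII c P ρ) = bndII c P ρ`. -/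
theorem absSum_qII (c : Cert3) (P : CertPolys3) (ρ : SPoly) : absSum (qII c P ρ) = bndII c P ρ := by
  obtain ⟨h1, h2, h3, h4, h5⟩ := absSum_perms (mul (gqU c.p c.q) P.E1)
  rw [qII, bndII, absSum_append, absSum_append, absSum_append, absSum_neg, absSum_neg, absSum_neg,
    targetII3, absSum_neg, absSum_append, absSum_C, Int.natAbs_natCast, absSum_C, Int.natAbs_natCast, rhsG]
  simp only [absSum_append, absSum_mul, h1, h3]
  ring

/-- `absSum (qI c P ρ) = bndI c P ρ`. -/
theorem absSum_qI (c : Cert3) (P : CertPolys3) (ρ : SPoly) : absSum (qI c P ρ) = bndI c P ρ := by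
  rw [qI, bndI, absSum_append, absSum_append, absSum_append, absSum_neg, absSum_neg, absSum_neg,
    absSum_neg, absSum_append, absSum_append, absSum_C, absSum_aGA, absSum_smul, absSum_substUU1,
    absSum_append, absSum_mul, absSum_C, Int.natAbs_natCast]
  simp

/-! ### Exponents -/

/-- Monomials of `gqU`: `a ≤ 2`, `b = c = 0`. -/
theorem exps_gqU (p : ℤ) (q : ℕ) (mc : Mono × ℤ) (h : mc ∈ gqU p q) : mc.1.a ≤ 2 ∧ mc.1.b = 0 ∧ mc.1.c = 0 := by
  simp only [gqU, List.mem_cons, List.mem_nil_iff, or_false] at h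
  rcases h with rfl | rfl | rfl <;> simp

/-- Monomials of the ghost multipliers `m2G`, `m3G` and of `p4` have all exponents `≤ 2`. -/
theorem exps_mults (p : ℤ) (q : ℕ) (mc : Mono × ℤ)
    (h : mc ∈ m2G p q ∨ mc ∈ m3G p q ∨ mc ∈ p4) : mc.1.a ≤ 2 ∧ mc.1.b ≤ 2 ∧ mc.1.c ≤ 2 := by
  have hB : ∀ x ∈ permBAC (gqU p q), x.1.a = 0 ∧ x.1.b ≤ 2 ∧ x.1.c = 0 := by
    intro x hx; simp only [permBAC, List.mem_map] at hx
    obtain ⟨y, hy, rfl⟩ := hx; have := exps_gqU p q y hy; simp; omega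
  have hC : ∀ x ∈ permCBA (gqU p q), x.1.a = 0 ∧ x.1.b = 0 ∧ x.1.c ≤ 2 := by
    intro x hx; simp only [permCBA, List.mem_map] at hx
    obtain ⟨y, hy, rfl⟩ := hx; have := exps_gqU p q y hy; simp; omega
  rcases h with h | h | h
  · simp only [m2G, List.mem_append] at h
    rcases h with (h | h) | h <;> obtain ⟨x, hx, y, hy, e⟩ := mem_mul _ _ mc h <;> rw [e] <;>
      simp only [Mono.mul]
    · have := exps_gqU p q x hx; have := hB y hy; omega
    · have := exps_gqU p q x hx; have := hC y hy; omega
    · have := hB x hx; have := hC y hy; omega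
  · obtain ⟨x, hx, yz, hyz, e⟩ := mem_mul _ _ mc h
    obtain ⟨y, hy, z, hz, e2⟩ := mem_mul _ _ yz hyz
    have := exps_gqU p q x hx; have := hB y hy; have := hC z hz
    rw [e, e2]; simp only [Mono.mul]; omega
  · simp only [p4, List.mem_cons, List.mem_nil_iff, or_false] at h
    rcases h with rfl | rfl | rfl | rfl | rfl <;> simp

/-- Unpacked `boxOK`. -/
theorem boxOK_spec (D : ℕ) (R : SPoly) (h : boxOK D R = true) (mc : Mono × ℤ) (hm : mc ∈ R) :
    mc.1.a < D ∧ mc.1.b < D ∧ mc.1.c < D := by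
  simp only [boxOK, List.all_eq_true, Bool.and_eq_true, Nat.blt_eq] at h
  exact ⟨(h mc hm).1.1, (h mc hm).1.2, (h mc hm).2⟩

/-- A product `m · E` with multiplier exponents `≤ 2` and `E` in the box `D − 2` is in the box `D`. -/
theorem exps_mul_small (D : ℕ) (m E : SPoly) (hm : ∀ x ∈ m, x.1.a ≤ 2 ∧ x.1.b ≤ 2 ∧ x.1.c ≤ 2)
    (hE : boxOK (D - 2) E = true) (mc : Mono × ℤ) (h : mc ∈ mul m E) :
    mc.1.a < D ∧ mc.1.b < D ∧ mc.1.c < D := by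
  obtain ⟨x, hx, y, hy, e⟩ := mem_mul _ _ mc h
  have h1 := hm x hx; have h2 := boxOK_spec _ _ hE y hy
  rw [e]; simp only [Mono.mul]; omega

/-- Monomials of `smul k p` are monomials of `p`. -/
theorem mem_smul_mono (k : ℤ) (p : SPoly) (mc : Mono × ℤ) (h : mc ∈ smul k p) : ∃ x ∈ p, mc.1 = x.1 := by
  simp only [smul, List.mem_map] at h
  obtain ⟨x, hx, rfl⟩ := h
  exact ⟨x, hx, rfl⟩

/-- Monomials of `neg p` are monomials of `p`. -/
theorem mem_neg_mono (p : SPoly) (mc : Mono × ℤ) (h : mc ∈ neg p) : ∃ x ∈ p, mc.1 = x.1 :=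
  mem_smul_mono (-1) p mc h

/-- The monomial of `C a`. -/
theorem mem_C_mono (a : ℤ) (mc : Mono × ℤ) (h : mc ∈ C a) : mc.1 = ⟨0, 0, 0⟩ := by
  simp only [C, List.mem_cons, List.mem_nil_iff, or_false] at h
  rw [h]

/-- Monomials of `permBAC p`. -/
theorem mem_permBAC_mono (p : SPoly) (mc : Mono × ℤ) (h : mc ∈ permBAC p) :
    ∃ x ∈ p, mc.1 = ⟨x.1.b, x.1.a, x.1.c⟩ := by
  simp only [permBAC, List.mem_map] at h
  obtain ⟨x, hx, rfl⟩ := h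
  exact ⟨x, hx, rfl⟩

/-- Monomials of `permCBA p`. -/
theorem mem_permCBA_mono (p : SPoly) (mc : Mono × ℤ) (h : mc ∈ permCBA p) :
    ∃ x ∈ p, mc.1 = ⟨x.1.c, x.1.b, x.1.a⟩ := by
  simp only [permCBA, List.mem_map] at h
  obtain ⟨x, hx, rfl⟩ := h
  exact ⟨x, hx, rfl⟩

/-- Exponents of the ghost right-hand side `rhsG` under the box side conditions. -/
theorem exps_rhsG (D : ℕ) (c : Cert3) (P : CertPolys3) (h0 : boxOK D P.E0 = true)
    (h1 : boxOK (D - 2) P.E1 = true) (h2 : boxOK (D - 2) P.E2 = true) (h3 : boxOK (D - 2) P.E3 = true)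
    (h4 : boxOK (D - 2) P.E4 = true) : ∀ mc ∈ rhsG c P, mc.1.a < D ∧ mc.1.b < D ∧ mc.1.c < D := by
  have hg : ∀ x ∈ gqU c.p c.q, x.1.a ≤ 2 ∧ x.1.b ≤ 2 ∧ x.1.c ≤ 2 := fun x hx => by
    have := exps_gqU c.p c.q x hx; omega
  have hgE1 := exps_mul_small D _ _ hg h1
  intro mc hmc
  unfold rhsG at hmc
  rcases List.mem_append.1 hmc with hmc | hmc
  · rcases List.mem_append.1 hmc with hmc | hmc
    · rcases List.mem_append.1 hmc with hmc | hmc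
      · rcases List.mem_append.1 hmc with hmc | hmc
        · rcases List.mem_append.1 hmc with hmc | hmc
          · rcases List.mem_append.1 hmc with hmc | hmc
            · exact boxOK_spec _ _ h0 mc hmc
            · exact hgE1 mc hmc
          · obtain ⟨x, hx, e⟩ := mem_permBAC_mono _ mc hmc
            have := hgE1 x hx; rw [e]; simp only; omega
        · obtain ⟨x, hx, e⟩ := mem_permCBA_mono _ mc hmc
          have := hgE1 x hx; rw [e]; simp only; omega
      · exact exps_mul_small D _ _ (fun x hx => exps_mults c.p c.q x (Or.inl hx)) h2 mc hmc
    · exact exps_mul_small D _ _ (fun x hx => exps_mults c.p c.q x (Or.inr (Or.inl hx))) h3 mc hmc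
  · exact exps_mul_small D _ _ (fun x hx => exps_mults c.p c.q x (Or.inr (Or.inr hx))) h4 mc hmc

/-- Exponents of `qII` under the side conditions of `idCheckII`. -/
theorem exps_qII (D : ℕ) (c : Cert3) (P : CertPolys3) (ρ : SPoly) (hD : 2 ≤ D)
    (hFP : boxOK D P.FP = true) (h0 : boxOK D P.E0 = true) (h1 : boxOK (D - 2) P.E1 = true)
    (h2 : boxOK (D - 2) P.E2 = true) (h3 : boxOK (D - 2) P.E3 = true) (h4 : boxOK (D - 2) P.E4 = true)
    (hρ : boxOK D ρ = true) : ∀ mc ∈ qII c P ρ, mc.1.a < D ∧ mc.1.b < D ∧ mc.1.c < D := by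
  intro mc hmc
  unfold qII at hmc
  rcases List.mem_append.1 hmc with hmc | hmc
  · rcases List.mem_append.1 hmc with hmc | hmc
    · rcases List.mem_append.1 hmc with hmc | hmc
      · -- targetII3 = neg (C B22 ++ FP)
        unfold targetII3 at hmc
        obtain ⟨x, hx, e⟩ := mem_neg_mono _ mc hmc
        rcases List.mem_append.1 hx with hx | hx
        · rw [e, mem_C_mono _ x hx]; simp only; omega
        · rw [e]; exact boxOK_spec _ _ hFP x hx
      · obtain ⟨x, hx, e⟩ := mem_neg_mono _ mc hmc
        rw [e]; exact exps_rhsG D c P h0 h1 h2 h3 h4 x hx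
    · obtain ⟨x, hx, e⟩ := mem_neg_mono _ mc hmc
      rw [e, mem_C_mono _ x hx]; simp only; omega
  · obtain ⟨x, hx, e⟩ := mem_neg_mono _ mc hmc
    rw [e]; exact boxOK_spec _ _ hρ x hx

/-- Exponents of `gegRaw n k`: `a ≤ k`, `b = c = 0`. -/
theorem exps_gegRaw (n : ℕ) : ∀ k, ∀ mc ∈ gegRaw n k, mc.1.a ≤ k ∧ mc.1.b = 0 ∧ mc.1.c = 0
  | 0, mc, h => by simp [gegRaw, C] at h; subst h; simp
  | 1, mc, h => by
    simp only [gegRaw, smul, U, List.map_cons, List.map_nil, List.mem_cons, List.mem_nil_iff, or_false] at h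
    subst h; simp
  | j + 2, mc, h => by
    simp only [gegRaw, smul, List.mem_append, List.mem_map] at h
    rcases h with ⟨a, ha, rfl⟩ | ⟨a, ha, rfl⟩
    · obtain ⟨x, hx, y, hy, e⟩ := mem_mul _ _ a ha
      simp only [U, List.mem_cons, List.mem_nil_iff, or_false] at hx
      have := exps_gegRaw n (j + 1) y hy
      rw [e, hx]; simp only [Mono.mul]; omega
    · have := exps_gegRaw n j a ha; simp only; omega

/-- Exponents of `aGA n d A k`: `a < k + |A|`, `b = c = 0`. -/
theorem exps_aGA (n d : ℕ) : ∀ (A : List ℕ) (k : ℕ), ∀ mc ∈ aGA n d A k, mc.1.a < k + A.length ∧ mc.1.b = 0 ∧ mc.1.c = 0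
  | [], k, mc, h => by simp [aGA] at h
  | a :: as, k, mc, h => by
    simp only [aGA, smul, List.mem_append, List.mem_map] at h
    rcases h with ⟨x, hx, rfl⟩ | h
    · have := exps_gegRaw n k x hx; simp only [List.length_cons]; omega
    · have := exps_aGA n d as (k + 1) mc h; simp only [List.length_cons]; omega

/-- Exponents of `qI` under the side conditions of `idCheckI`. -/
theorem exps_qI (D : ℕ) (c : Cert3) (P : CertPolys3) (ρ : SPoly) (hD : 2 ≤ D) (hA : c.A.length ≤ D)
    (hFP : boxOK D (substUU1 P.FP) = true) (h0 : boxOK D P.EQ0 = true) (h1 : boxOK (D - 2) P.EQ1 = true)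
    (hρ : boxOK D ρ = true) : ∀ mc ∈ qI c P ρ, mc.1.a < D ∧ mc.1.b < D ∧ mc.1.c < D := by
  have hg : ∀ x ∈ gqU c.p c.q, x.1.a ≤ 2 ∧ x.1.b ≤ 2 ∧ x.1.c ≤ 2 := fun x hx => by
    have := exps_gqU c.p c.q x hx; omega
  intro mc hmc
  unfold qI at hmc
  rcases List.mem_append.1 hmc with hmc | hmc
  · rcases List.mem_append.1 hmc with hmc | hmc
    · rcases List.mem_append.1 hmc with hmc | hmc
      · obtain ⟨x, hx, e⟩ := mem_neg_mono _ mc hmc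
        rw [e]
        rcases List.mem_append.1 hx with hx | hx
        · rcases List.mem_append.1 hx with hx | hx
          · rw [mem_C_mono _ x hx]; simp only; omega
          · have := exps_aGA c.n c.d c.A 0 x hx; omega
        · obtain ⟨y, hy, e2⟩ := mem_smul_mono _ _ x hx
          rw [e2]; exact boxOK_spec _ _ hFP y hy
      · obtain ⟨x, hx, e⟩ := mem_neg_mono _ mc hmc
        rw [e]
        rcases List.mem_append.1 hx with hx | hx
        · exact boxOK_spec _ _ h0 x hx
        · exact exps_mul_small D _ _ hg h1 x hx
    · obtain ⟨x, hx, e⟩ := mem_neg_mono _ mc hmc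
      rw [e, mem_C_mono _ x hx]; simp only; omega
  · obtain ⟨x, hx, e⟩ := mem_neg_mono _ mc hmc
    rw [e]; exact boxOK_spec _ _ hρ x hx

/-! ### The identities from the checks -/

/-- From `idCheckII`: the exact identity `target = rhs + c₀ + ρ` and `Σ|ρ| ≤ c₀`. -/
theorem idII_spec (w D : ℕ) (c : Cert3) (P : CertPolys3) (ρ : SPoly) (h : idCheckII w D c P ρ = true) :
    (∀ u v t : ℝ, eval (targetII3 c P) u v t = eval (rhsII3S2 c P) u v t + c.c0 + eval ρ u v t) ∧
      absSum ρ ≤ c.c0 := by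
  unfold idCheckII at h
  simp only [Bool.and_eq_true, decide_eq_true_eq] at h
  obtain ⟨⟨⟨⟨⟨⟨⟨⟨⟨⟨hD, hFP⟩, h0⟩, h1⟩, h2⟩, h3⟩, h4⟩, hρ⟩, hab⟩, hw⟩, hval⟩ := h
  refine ⟨fun u v t => ?_, hab⟩
  have hQ := eval_eq_zero_of_kronecker w D (qII c P ρ) (exps_qII D c P ρ hD hFP h0 h1 h2 h3 h4 hρ)
    (by rw [absSum_qII]; exact hw) (by rw [← valII_eq]; exact hval) u v t
  rw [eval_qII] at hQ
  linarith

/-- From `idCheckI`: the exact identity of `(i')` and `Σ|ρ₁| ≤ c₀₁`. -/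
theorem idI_spec (w D : ℕ) (c : Cert3) (P : CertPolys3) (ρ : SPoly) (h : idCheckI w D c P ρ = true) :
    (∀ u v t : ℝ, eval (targetI3 c P) u v t = eval (rhsI3 c P) u v t + c.c01 + eval ρ u v t) ∧
      absSum ρ ≤ c.c01 := by
  unfold idCheckI at h
  simp only [Bool.and_eq_true, decide_eq_true_eq] at h
  obtain ⟨⟨⟨⟨⟨⟨⟨⟨hD, hA⟩, hFP⟩, h0⟩, h1⟩, hρ⟩, hab⟩, hw⟩, hval⟩ := h
  refine ⟨fun u v t => ?_, hab⟩
  have hQ := eval_eq_zero_of_kronecker w D (qI c P ρ) (exps_qI D c P ρ hD hA hFP h0 h1 hρ)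
    (by rw [absSum_qI]; exact hw) (by rw [← valI_eq]; exact hval) u v t
  rw [eval_qI] at hQ
  linarith

/-! ### Soundness -/

set_option maxHeartbeats 4000000 in
/-- Soundness of `(ii')` in mode `sym2` from the Kronecker-substitution identity check (weak
hypothesis `PolysNN3`): on `D'`, `F ≤ -b₂₂` (in units). -/
theorem FII3S2_of_idKS (w D : ℕ) (c : Cert3) (P : CertPolys3) (hP : PolysNN3 c P) (ρ : SPoly)
    (hk : idCheckII w D c P ρ = true) (hs : checkSide3 c = true) (u v t : ℝ)
    (hu : -1 ≤ u) (hu' : u ≤ (c.p : ℝ) / c.q) (hv : -1 ≤ v) (hv' : v ≤ (c.p : ℝ) / c.q)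
    (ht : -1 ≤ t) (ht' : t ≤ (c.p : ℝ) / c.q)
    (hp : 0 ≤ 1 + 2 * u * v * t - u ^ 2 - v ^ 2 - t ^ 2) :
    FvalG c.n c.F u v t / 2 ^ (2 * c.S) ≤ -((c.B22 : ℝ) / c.DDW) := by
  obtain ⟨hn, hq, hpq, _, hAlen, hFk, _⟩ := side_of_check c hs
  have hu1 := abs_le_one_of_box c.p c.q hq hpq u hu hu'
  have hv1 := abs_le_one_of_box c.p c.q hq hpq v hv hv'
  have ht1 := abs_le_one_of_box c.p c.q hq hpq t ht ht'
  have hrhs : 0 ≤ eval (rhsII3S2 c P) u v t :=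
    rhsII3S2_nonnegNN c P hP hq hpq u v t hu hu' hv hv' ht ht' hp
  obtain ⟨hid, hab⟩ := idII_spec w D c P ρ hk
  have hρ := abs_eval_le ρ hu1 hv1 ht1
  have hab' : (absSum ρ : ℝ) ≤ c.c0 := by exact_mod_cast hab
  have htgt : 0 ≤ eval (targetII3 c P) u v t := by
    rw [hid u v t]
    have := (abs_le.1 hρ).1
    linarith
  rw [targetII3, eval_neg, eval_append, eval_C, hP.hF u v t hu1 hv1 ht1,
    eval_FPolyG c.n c.d c.F hFk] at htgt
  push_cast at htgt
  have hW : (0 : ℝ) < Wfac c.d := by exact_mod_cast Wfac_pos c.d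
  have hD' : (0 : ℝ) < 2 ^ (2 * c.S) := pow_pos (by norm_num) _
  have hDDW : (c.DDW : ℝ) = 2 ^ (2 * c.S) * (Wfac c.d : ℝ) := by simp [Cert3.DDW]
  have key : FvalG c.n c.F u v t * (Wfac c.d : ℝ) ≤ -(c.B22 : ℝ) := by linarith
  rw [hDDW, div_le_iff₀ hD']
  have e : -((c.B22 : ℝ) / (2 ^ (2 * c.S) * Wfac c.d)) * 2 ^ (2 * c.S) = -(c.B22 : ℝ) / Wfac c.d := by
    field_simp
  rw [e, le_div_iff₀ hW]
  exact key

set_option maxHeartbeats 4000000 in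
/-- Soundness of `(i')` from the Kronecker-substitution identity check (weak hypothesis): on
`[-1, s]`, `A(u) + 3F(u,u,1) ≤ -1 - 2b₁₂ - b₂₂` (in units). -/
theorem AF3_of_idKS (w D : ℕ) (c : Cert3) (P : CertPolys3) (hP : PolysNN3 c P) (ρ : SPoly)
    (hk : idCheckI w D c P ρ = true) (hs : checkSide3 c = true) (u : ℝ) (hu : -1 ≤ u)
    (hu' : u ≤ (c.p : ℝ) / c.q) :
    AvalG c.n c.A u / 2 ^ (2 * c.S) + 3 * (FvalG c.n c.F u u 1 / 2 ^ (2 * c.S)) ≤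
      -1 - 2 * ((c.B12 : ℝ) / c.DDW) - (c.B22 : ℝ) / c.DDW := by
  obtain ⟨hn, hq, hpq, _, hAlen, hFk, _⟩ := side_of_check c hs
  have hu1 := abs_le_one_of_box c.p c.q hq hpq u hu hu'
  have h01 : |(0 : ℝ)| ≤ 1 := by norm_num
  have h11 : |(1 : ℝ)| ≤ 1 := by norm_num
  have gu := gq_nonneg c.p c.q u hu (qmul_le_of_box c.p c.q hq u hu')
  have hrhs : 0 ≤ eval (rhsI3 c P) u 0 0 := by
    have e0 := hP.hq0 u 0 0 hu1 h01 h01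
    have e1 := hP.hq1 u 0 0 hu1 h01 h01
    rw [rhsI3, eval_mergeAll]
    simp only [List.map_cons, List.map_nil, List.sum_cons, List.sum_nil, add_zero, eval_mulN,
      eval_gqU]
    nlinarith [mul_nonneg gu e1]
  obtain ⟨hid, hab⟩ := idI_spec w D c P ρ hk
  have hρ := abs_eval_le ρ hu1 h01 h01
  have hab' : (absSum ρ : ℝ) ≤ c.c01 := by exact_mod_cast hab
  generalize hR : eval (rhsI3 c P) u 0 0 = R at hid hrhs
  have htgt : 0 ≤ eval (targetI3 c P) u 0 0 := by
    rw [hid u 0 0]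
    have := (abs_le.1 hρ).1
    linarith
  have hFss : eval (substUU1 P.FP) u 0 0 = (Wfac c.d : ℝ) * FvalG c.n c.F u u 1 := by
    rw [eval_substUU1, hP.hF u u 1 hu1 hu1 h11, eval_FPolyG c.n c.d c.F hFk]
  rw [targetI3, eval_neg, eval_append, eval_append, eval_C, eval_smul, hFss,
    eval_APolyG c.n c.d c.A hAlen.le] at htgt
  push_cast at htgt
  have hW : (0 : ℝ) < Wfac c.d := by exact_mod_cast Wfac_pos c.d
  have hD' : (0 : ℝ) < 2 ^ (2 * c.S) := pow_pos (by norm_num) _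
  have hDDW : (c.DDW : ℝ) = 2 ^ (2 * c.S) * (Wfac c.d : ℝ) := by simp [Cert3.DDW]
  rw [hDDW] at htgt ⊢
  have hDW : (0 : ℝ) < 2 ^ (2 * c.S) * (Wfac c.d : ℝ) := mul_pos hD' hW
  generalize hAv : AvalG c.n c.A u = AV at htgt ⊢
  generalize hFv : FvalG c.n c.F u u 1 = FV at htgt ⊢
  have key : (Wfac c.d : ℝ) * (AV + 3 * FV) ≤
      -(2 ^ (2 * c.S) * (Wfac c.d : ℝ)) - 2 * (c.B12 : ℝ) - (c.B22 : ℝ) := by linarith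
  have lhs_eq : AV / 2 ^ (2 * c.S) + 3 * (FV / 2 ^ (2 * c.S)) =
      ((Wfac c.d : ℝ) * (AV + 3 * FV)) / (2 ^ (2 * c.S) * Wfac c.d) := by
    field_simp
  have rhs_eq : -1 - 2 * ((c.B12 : ℝ) / (2 ^ (2 * c.S) * Wfac c.d)) - (c.B22 : ℝ) / (2 ^ (2 * c.S) * Wfac c.d)
      = (-(2 ^ (2 * c.S) * (Wfac c.d : ℝ)) - 2 * (c.B12 : ℝ) - (c.B22 : ℝ)) / (2 ^ (2 * c.S) * Wfac c.d) := by
    field_simp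
  rw [lhs_eq, rhs_eq]
  exact div_le_div_of_nonneg_right key hDW.le

/-- **The bound from a checked certificate (Bachoc–Vallentin multiplier set, mode `sym2`) with
the identities `(i')`, `(ii')` checked by Kronecker substitution** (`idCheckI`, `idCheckII`, residuals
`ρ₁`, `ρ` as data) and the weak validity package `PolysNN3`; conclusion exactly as
`card_le_of_cert3S2splitNN`: every finite set of unit vectors of `ℝⁿ` (`n = c.n ≥ 4`) with pairwise
inner products `≤ c.p/c.q` has at most `c.N` elements. -/
theorem card_le_of_cert3KS (w₁ D₁ w₂ D₂ : ℕ) (c : Cert3) (P : CertPolys3) (hP : PolysNN3 c P)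
    (ρ₁ ρ₂ : SPoly) (hI : idCheckI w₁ D₁ c P ρ₁ = true) (hII : idCheckII w₂ D₂ c P ρ₂ = true)
    (hs : checkSide3 c = true) (hb3 : checkBound3 c P = true)
    (C : Finset (EuclideanSpace ℝ (Fin c.n))) (hC : ∀ x ∈ C, ‖x‖ = 1)
    (hcode : ∀ x ∈ C, ∀ y ∈ C, x ≠ y → inner ℝ x y ≤ (c.p : ℝ) / c.q) : C.card ≤ c.N := by
  obtain ⟨hn, hq, hpq, _, hAlen, hFk, _⟩ := side_of_check c hs
  have hbd := bound3_of_check c P hP.hF hs hb3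
  have hD : (0 : ℝ) < 2 ^ (2 * c.S) := pow_pos (by norm_num) _
  have hA : 0 ≤ BachocVallentin.pairSum C (fun u => AvalG c.n c.A u / 2 ^ (2 * c.S)) := by
    have h0 := pairSum_AvalG_nonneg (by omega : 3 ≤ c.n) c.A C hC
    unfold BachocVallentin.pairSum at h0 ⊢
    have e : (∑ x ∈ C, ∑ y ∈ C, AvalG c.n c.A (inner ℝ x y) / 2 ^ (2 * c.S)) =
        (∑ x ∈ C, ∑ y ∈ C, AvalG c.n c.A (inner ℝ x y)) / 2 ^ (2 * c.S) := by
      rw [Finset.sum_div]; refine Finset.sum_congr rfl fun x _ => ?_; rw [Finset.sum_div]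
    rw [e]; exact div_nonneg h0 hD.le
  have hF : 0 ≤ BachocVallentin.tripleSum C (fun u v t => FvalG c.n c.F u v t / 2 ^ (2 * c.S)) := by
    have h0 := tripleSum_FvalG_nonneg hn c.F C hC
    unfold BachocVallentin.tripleSum at h0 ⊢
    have e : (∑ x ∈ C, ∑ y ∈ C, ∑ z ∈ C,
        FvalG c.n c.F (inner ℝ x y) (inner ℝ x z) (inner ℝ y z) / 2 ^ (2 * c.S))
        = (∑ x ∈ C, ∑ y ∈ C, ∑ z ∈ C,
          FvalG c.n c.F (inner ℝ x y) (inner ℝ x z) (inner ℝ y z)) / 2 ^ (2 * c.S) := by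
      rw [Finset.sum_div]; refine Finset.sum_congr rfl fun x _ => ?_
      rw [Finset.sum_div]; refine Finset.sum_congr rfl fun y _ => ?_
      rw [Finset.sum_div]
    rw [e]; exact div_nonneg h0 hD.le
  have h := BachocVallentin.card_le_of_threePoint ((c.p : ℝ) / c.q) C hC hcode
    (fun u => AvalG c.n c.A u / 2 ^ (2 * c.S)) (fun u v t => FvalG c.n c.F u v t / 2 ^ (2 * c.S))
    ((c.B11 : ℝ) / c.DDW) ((c.B12 : ℝ) / c.DDW) ((c.B22 : ℝ) / c.DDW) hA hF
    (fun u v t => by rw [FvalG_swap12])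
    (fun u v t => by rw [FvalG_swap23])
    (bquad3_nonneg_of_check c hs)
    (fun u hu hu' => AF3_of_idKS w₁ D₁ c P hP ρ₁ hI hs u hu hu')
    (fun u v t hu hu' hv hv' ht ht' hp =>
      FII3S2_of_idKS w₂ D₂ c P hP ρ₂ hII hs u v t hu hu' hv hv' ht ht' hp)
    hbd.2
  have hlt : (C.card : ℝ) < (c.N : ℝ) + 1 := lt_of_le_of_lt h hbd.1
  have hlt' : C.card < c.N + 1 := by exact_mod_cast hlt
  omega

end Summit.Ventures.PackingBounds.ThreePointCert

end
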